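import Literature.MathematicalPhysics.QuantumFieldTheory.ConformalBootstrap3D.MixedOddRadialRules
import Literature.MathematicalPhysics.QuantumFieldTheory.ConformalBootstrap3D.BlockCoefficientExtraction
import Mathlib.Analysis.Normed.Group.InfiniteSum
import Mathlib.Topology.Algebra.InfiniteSum.Real
import HarnessLib

/-!
# Uniqueness of the radial (Gegenbauer) expansion of a function on the square

Hogervorst–Rychkov 2013 §3 expand a conformal block in the radial coordinate `ρ(z) = z/(1+√(1-z))²`
as `G = Σ_{n,j} B_{n,j} 𝒫_{Δ+n,j}(r,η)`, `𝒫_{E,j}(r,η) = r^E P_j(η)`, with spins `j ≤ ℓ + n` at level `n`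
(their eq. (3.4)–(3.5) and the constraint "eq:j"); Costa–Hansen–Penedones–Trevisani 2016 §2.1 do the same
for unequal external dimensions (the prefactored block, coefficients `w(m,j)`, `w(m,j) = 0` for
`|j - ℓ| > m`). In the tree such an expansion of a function `g` on the real square `(0,1)²` is the
HYPOTHESIS `HasRadialExpansion c Δ w g` (`MixedOddRadial`), and the would-be block clause "A2ρ" is
`RadialPairClause` (`MixedOddRadialRules`), which asserts the EXISTENCE of a non-negative table `w`
supported on `j ≤ ℓ + m`.

This file proves that such a table is UNIQUE: two radial expansions of the same function on the square
(indeed on any sub-square `(0,δ)²` of the `ρ`-square), both supported on `j ≤ ℓ + m`, have the same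
coefficient table (`RadialSupport.eq_zero_of_hasSum_zero`, `HasRadialExpansion.unique`,
`HasSignedRadialExpansion.unique`, `RadialPairClause.table_unique`). This is the radial-frame analogue
of the coefficient uniqueness `BlockCoefficientUniqueness` / `IsConformalBlock3DAbove.eqOn_of_isRegular`
asked for by the referee as the Lean consistency witness of an A2ρ clause (pub-ising3d REFEREE.md F82
(a)): the clause introduces no freedom beyond the typed block — the block is pinned by the `z`-frame
chain, and its radial table, if it exists, is pinned by this file. No parity condition `j ≡ ℓ + m` is
assumed (the proof works in the square-root coordinates `(s,u) = (√ρ, √ρ̄)`, where a radial term of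
level `m` is a homogeneous polynomial of degree `2(ℓ+m)` times `(su)^{Δ-ℓ}`, whatever the parity of `j`).
A level-wise form of the triangularity, `row_eq_of_sum_radialArr_eq` / `RadialSupport.row_eq`, lets a
certificate confirm a candidate row `w(m,·)` against a known monomial array by finitely many identities.

The argument (elementary; Hogervorst–Rychkov 2013 §3 "first method" read backwards): at a point
`(ρ,ρ̄) = (s²,u²)` the term `𝒫_{Δ+m,j}(ρ,ρ̄) = (ρρ̄)^{(Δ+m-j)/2} Σ_{i+k=j} λ_iλ_k ρ^i ρ̄^k` equals
`(su)^{Δ-ℓ} Σ_{i+k=j} λ_iλ_k s^{(ℓ+m-j)+2i} u^{(ℓ+m-j)+2k}` (`radialArr`,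
`sum_antidiagonal_radialArr_mul_pow`); an unconditionally (= absolutely) convergent radial series
therefore regroups into a double power series in `(s,u)` (`hasSum_radialMonArr`; rows are finite by the
support condition, the regrouping is dominated by the series of absolute values); a double power series
vanishing on a square has zero coefficients (`eq_zero_of_double_tsum_eq_zero`, here on `(0,δ)²`:
`eq_zero_of_double_tsum_eq_zero_of_pos`); and within total degree `2(ℓ+m)` the monomial
`s^{ℓ+m+j} u^{ℓ+m-j}` is reached only from spins `j' ≥ j`, with coefficient `λ_j λ_0 = λ_j ≠ 0` from
`j' = j` (`radialArr_corner_self`, `radialArr_corner_eq_zero_of_lt`), so the spin coefficients are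
recovered by downward induction (`eq_zero_of_sum_radialArr_eq_zero`). The transfer from the `ρ`-square to
the `z`-square is the bijection `z(ρ) = 4ρ/(1+ρ)²`, `ρ(z(ρ)) = ρ` of `BlockRadialCoordinate`.

What is NOT here: existence of a radial expansion for a typed block (that is the content of A2ρ /
analytic continuation to the `ρ`-disc, Hogervorst–Rychkov 2013 §3.1, not formalised), any value of a
radial coefficient, any positivity statement.

Sources: M. Hogervorst, S. Rychkov, Phys. Rev. D 87 (2013) 106004, arXiv:1303.1111, §3 eqs. (3.1),
(3.4)–(3.6) and the "first method" paragraph; M. S. Costa, T. Hansen, J. Penedones, E. Trevisani,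
JHEP 07 (2016) 057, arXiv:1603.05552, §2.1 eqs. (2.11), (2.14)–(2.15). Mathlib: `HasSum.prod_fiberwise`,
`Function.Injective.hasSum_iff`, `summable_sigma_of_nonneg`, `Finset.HasAntidiagonal.sigmaAntidiagonalEquivProd`,
`Summable.of_norm_bounded`, `Summable.abs`. Tree: `zMono`, `zLegendre`, `legendreLam`, `rhoOf`, `zOfRho`,
`HasRadialExpansion`, `HasSignedRadialExpansion`, `RadialPairClause`, `eq_zero_of_double_tsum_eq_zero`,
`hasSum_sum_antidiagonal_of_summable`.
-/

namespace Literature.MathematicalPhysics.QuantumFieldTheory.ConformalBootstrap3D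

open Finset Set

/-! ### Support condition of a radial table -/

/-- A radial coefficient table `d(m,j)` (level `m`, spin `j`) for base spin `ℓ` is *supported on the
descendant range* when `d(m,j) = 0` for `j > ℓ + m` (Hogervorst–Rychkov 2013 §3: "the spins `j` at level
`n` will still be subject to the constraint" `j ≤ ℓ + n`; Costa–Hansen–Penedones–Trevisani 2016 eq. (2.15):
`w(m,j) = 0` for `|j - ℓ| > m`). This is exactly the support clause of `RadialPairClause`.
[cite: HogervorstRychkov2013, §3 eq. (3.5)] -/
def RadialSupport (ℓ : ℕ) (d : ℕ × ℕ → ℝ) : Prop :=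
  ∀ q : ℕ × ℕ, ℓ + q.1 < q.2 → d q = 0

/-- The difference of two supported tables is supported. [folklore] -/
theorem RadialSupport.sub {ℓ : ℕ} {d d' : ℕ × ℕ → ℝ} (hd : RadialSupport ℓ d)
    (hd' : RadialSupport ℓ d') : RadialSupport ℓ (fun q => d q - d' q) := fun q hq => by
  simp only [hd q hq, hd' q hq, sub_zero]

/-- The absolute value of a supported table is supported. [folklore] -/
theorem RadialSupport.abs {ℓ : ℕ} {d : ℕ × ℕ → ℝ} (hd : RadialSupport ℓ d) :
    RadialSupport ℓ (fun q => |d q|) := fun q hq => by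
  simp only [hd q hq, abs_zero]

/-- A supported table times any weight is supported. [folklore] -/
theorem RadialSupport.mul_left {ℓ : ℕ} {d : ℕ × ℕ → ℝ} (hd : RadialSupport ℓ d) (c : ℕ × ℕ → ℝ) :
    RadialSupport ℓ (fun q => c q * d q) := fun q hq => by
  simp only [hd q hq, mul_zero]

/-! ### The monomial array of a radial term in the square-root coordinates `(s,u) = (√ρ, √ρ̄)` -/

/-- `radialArr N j (a,b) := λ_i λ_k` when `a = (N-j) + 2i`, `b = (N-j) + 2k` with `i + k = j ≤ N`
(so `a + b = 2N`), and `0` otherwise: the coefficient of `s^a u^b` in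
`(su)^{N-j} 𝒫_j(s², u²) = (su)^{N-j} Σ_{i+k=j} λ_i λ_k s^{2i} u^{2k}` — the level-`(N-ℓ)`, spin-`j`
radial term `r^{N} P_j(η)` with `(ρ,ρ̄) = (s², u²)`, stripped of `(su)^{Δ-ℓ}`.
(Hogervorst–Rychkov 2013, §3 eq. (3.6): `P_j(cos θ) = Σ_{i+k=j} λ_iλ_k e^{i(i-k)θ}`.)
[cite: HogervorstRychkov2013, §3 eq. (3.6)] -/
noncomputable def radialArr (N j : ℕ) (p : ℕ × ℕ) : ℝ :=
  if j ≤ N ∧ N - j ≤ p.1 ∧ N - j ≤ p.2 ∧ p.1 + p.2 = 2 * N ∧ (p.1 - (N - j)) % 2 = 0 then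
    legendreLam ((p.1 - (N - j)) / 2) * legendreLam ((p.2 - (N - j)) / 2)
  else 0

/-- `radialArr ≥ 0` entrywise. [folklore] -/
theorem radialArr_nonneg (N j : ℕ) (p : ℕ × ℕ) : 0 ≤ radialArr N j p := by
  unfold radialArr
  split_ifs
  · exact mul_nonneg (legendreLam_pos _).le (legendreLam_pos _).le
  · exact le_rfl

/-- Evaluation on the support: `radialArr N j ((N-j)+2i, (N-j)+2k) = λ_i λ_k` for `i + k = j ≤ N`.
[folklore] -/
theorem radialArr_pair {N j : ℕ} (hj : j ≤ N) (c : ℕ × ℕ) (hc : c.1 + c.2 = j) :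
    radialArr N j (N - j + 2 * c.1, N - j + 2 * c.2) = legendreLam c.1 * legendreLam c.2 := by
  unfold radialArr
  have h1 : (N - j + 2 * c.1 - (N - j)) / 2 = c.1 := by omega
  have h2 : (N - j + 2 * c.2 - (N - j)) / 2 = c.2 := by omega
  rw [if_pos ⟨hj, by simp only; omega, by simp only; omega, by simp only; omega, by simp only; omega⟩]
  simp only
  rw [h1, h2]

/-- Vanishing off the image of `c ↦ ((N-j)+2c₁, (N-j)+2c₂)`, `c₁ + c₂ = j`. [folklore] -/
theorem radialArr_eq_zero_of_not_mem_image {N j : ℕ} {p : ℕ × ℕ}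
    (h : p ∉ (antidiagonal j).image (fun c : ℕ × ℕ => (N - j + 2 * c.1, N - j + 2 * c.2))) :
    radialArr N j p = 0 := by
  unfold radialArr
  split_ifs with hc
  · exfalso
    obtain ⟨hjN, h1, h2, h3, h4⟩ := hc
    apply h
    rw [Finset.mem_image]
    refine ⟨((p.1 - (N - j)) / 2, (p.2 - (N - j)) / 2), ?_, ?_⟩
    · rw [mem_antidiagonal]
      simp only
      omega
    · exact Prod.ext (by simp only; omega) (by simp only; omega)
  · rfl

/-- `radialArr N j = 0` for `j > N`. [folklore] -/
theorem radialArr_eq_zero_of_lt {N j : ℕ} (h : N < j) (p : ℕ × ℕ) : radialArr N j p = 0 := by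
  unfold radialArr
  rw [if_neg]
  rintro ⟨h1, -⟩
  omega

/-- `radialArr N j` is supported on the antidiagonal of degree `2N`. [folklore] -/
theorem radialArr_eq_zero_of_ne {N j : ℕ} {p : ℕ × ℕ} (h : p.1 + p.2 ≠ 2 * N) : radialArr N j p = 0 := by
  unfold radialArr
  rw [if_neg]
  rintro ⟨-, -, -, h4, -⟩
  exact h h4

/-- **The corner monomial of spin `j`**: at `(a,b) = (N+j, N-j)` (`i = j`, `k = 0`) the array takes the
value `λ_j λ_0 = λ_j`. [folklore] -/
theorem radialArr_corner_self {N j : ℕ} (hj : j ≤ N) : radialArr N j (N + j, N - j) = legendreLam j := by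
  have h := radialArr_pair hj (j, 0) (by simp)
  simp only [mul_zero, add_zero, legendreLam_zero, mul_one] at h
  rwa [show N - j + 2 * j = N + j by omega] at h

/-- **Triangularity**: a spin `j' < j` does not reach the corner monomial `(N+j, N-j)` of spin `j`
(its monomials have both exponents `≥ N - j' > N - j`). [folklore] -/
theorem radialArr_corner_eq_zero_of_lt {N j j' : ℕ} (hj'j : j' < j) (hj : j ≤ N) :
    radialArr N j' (N + j, N - j) = 0 := by
  unfold radialArr
  rw [if_neg]
  rintro ⟨-, -, h3, -, -⟩
  simp only at h3
  omega

/-- **Monomial expansion of a radial term in the square-root coordinates**: for `j ≤ N`,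
`Σ_{a+b=2N} radialArr N j (a,b) s^a u^b = (su)^{N-j} 𝒫_j(s², u²)`.
[cite: HogervorstRychkov2013, §3 eq. (3.6)] -/
theorem sum_antidiagonal_radialArr_mul_pow {N j : ℕ} (hj : j ≤ N) (s u : ℝ) :
    ∑ p ∈ antidiagonal (2 * N), radialArr N j p * s ^ p.1 * u ^ p.2 =
      (s * u) ^ (N - j) * zLegendre j (s ^ 2) (u ^ 2) := by
  classical
  have hinj : Set.InjOn (fun c : ℕ × ℕ => (N - j + 2 * c.1, N - j + 2 * c.2)) ↑(antidiagonal j) := by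
    intro a _ b _ h
    simp only [Prod.mk.injEq] at h
    exact Prod.ext (by omega) (by omega)
  have hsub : (antidiagonal j).image (fun c : ℕ × ℕ => (N - j + 2 * c.1, N - j + 2 * c.2)) ⊆
      antidiagonal (2 * N) := by
    intro p hp
    rw [Finset.mem_image] at hp
    obtain ⟨c, hc, rfl⟩ := hp
    rw [mem_antidiagonal] at hc ⊢
    simp only
    omega
  have hzero : ∀ p ∈ antidiagonal (2 * N),
      p ∉ (antidiagonal j).image (fun c : ℕ × ℕ => (N - j + 2 * c.1, N - j + 2 * c.2)) →
        radialArr N j p * s ^ p.1 * u ^ p.2 = 0 := by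
    intro p _ hnot
    rw [radialArr_eq_zero_of_not_mem_image hnot, zero_mul, zero_mul]
  rw [← sum_subset hsub hzero, sum_image hinj]
  unfold zLegendre
  rw [mul_sum]
  refine sum_congr rfl fun c hc => ?_
  rw [mem_antidiagonal] at hc
  simp only
  rw [radialArr_pair hj c hc, pow_add, pow_add, pow_mul, pow_mul, mul_pow]
  ring

/-- **Spin coefficients are determined by the monomial coefficients within a level.** If a finite
combination `Σ_{j ≤ N} c_j · radialArr N j` vanishes on the antidiagonal of degree `2N`, then every
`c_j`, `j ≤ N`, vanishes (downward induction on `j` along the corner monomials `(N+j, N-j)`;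
`λ_j ≠ 0`). No parity condition on `j` is needed. [folklore] -/
theorem eq_zero_of_sum_radialArr_eq_zero (N : ℕ) (c : ℕ → ℝ)
    (h : ∀ p ∈ antidiagonal (2 * N), ∑ j ∈ range (N + 1), c j * radialArr N j p = 0) :
    ∀ j, j ≤ N → c j = 0 := by
  have H : ∀ n j, N - j = n → j ≤ N → c j = 0 := by
    intro n
    induction n using Nat.strong_induction_on with
    | _ n ih =>
      intro j hn hj
      have hp : (N + j, N - j) ∈ antidiagonal (2 * N) := by
        rw [mem_antidiagonal]
        omega
      have hsum := h _ hp
      rw [sum_eq_single j] at hsum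
      · rw [radialArr_corner_self hj] at hsum
        exact (mul_eq_zero.mp hsum).resolve_right (legendreLam_ne_zero j)
      · intro j' hj' hne
        rcases lt_or_gt_of_ne hne with hlt | hgt
        · rw [radialArr_corner_eq_zero_of_lt hlt hj, mul_zero]
        · have hj'N : j' ≤ N := by
            have := Finset.mem_range.mp hj'
            omega
          rw [ih (N - j') (by omega) j' rfl hj'N, zero_mul]
      · intro hjr
        exact absurd (Finset.mem_range.mpr (by omega)) hjr
  intro j hj
  exact H _ j rfl hj

/-! ### The identity theorem for real double power series on a sub-square -/

/-- A real double power series `Σ L(a,b) z^a z̄^b`, convergent and vanishing at every point of a square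
`(0,δ)²`, `δ > 0`, has all coefficients zero (rescaling of `eq_zero_of_double_tsum_eq_zero`).
[folklore] -/
theorem eq_zero_of_double_tsum_eq_zero_of_pos (L : ℕ × ℕ → ℝ) {δ : ℝ} (hδ : 0 < δ)
    (h : ∀ z zb : ℝ, 0 < z → z < δ → 0 < zb → zb < δ →
      Summable (fun q : ℕ × ℕ => L q * z ^ q.1 * zb ^ q.2) ∧
        ∑' q : ℕ × ℕ, L q * z ^ q.1 * zb ^ q.2 = 0) :
    L = 0 := by
  have h' := eq_zero_of_double_tsum_eq_zero (fun q => L q * δ ^ q.1 * δ ^ q.2) (by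
    intro z zb hz0 hz1 hzb0 hzb1
    obtain ⟨hs, ht⟩ := h (δ * z) (δ * zb) (by positivity) (mul_lt_of_lt_one_right hδ hz1)
      (by positivity) (mul_lt_of_lt_one_right hδ hzb1)
    have hfun : (fun q : ℕ × ℕ => L q * (δ * z) ^ q.1 * (δ * zb) ^ q.2) =
        fun q => L q * δ ^ q.1 * δ ^ q.2 * z ^ q.1 * zb ^ q.2 := by
      funext q
      rw [mul_pow, mul_pow]
      ring
    rw [hfun] at hs ht
    exact ⟨hs, ht⟩)
  funext q
  have h1 : L q * δ ^ q.1 * δ ^ q.2 = 0 := congrFun h' q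
  have h2 : δ ^ q.1 * δ ^ q.2 ≠ 0 := mul_ne_zero (pow_ne_zero _ hδ.ne') (pow_ne_zero _ hδ.ne')
  have h3 : L q * (δ ^ q.1 * δ ^ q.2) = 0 := by rw [← mul_assoc]; exact h1
  exact (mul_eq_zero.mp h3).resolve_right h2

/-! ### From antidiagonal block sums to the double series -/

/-- A non-negative family on `ℕ × ℕ` whose antidiagonal block sums are summable is summable. [folklore] -/
theorem summable_of_hasSum_antidiagonal_of_nonneg {E : ℕ × ℕ → ℝ} (hE : ∀ p, 0 ≤ E p) {S : ℝ}
    (h : HasSum (fun M : ℕ => ∑ p ∈ antidiagonal M, E p) S) : Summable E := by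
  have h1 : Summable (fun x : (Σ M : ℕ, ↥(antidiagonal M)) => E (x.2 : ℕ × ℕ)) := by
    refine (summable_sigma_of_nonneg (fun x => hE _)).mpr ⟨fun M => ?_, ?_⟩
    · exact (hasSum_fintype _).summable
    · have hf : (fun M : ℕ => ∑' y : ↥(antidiagonal M), E (y : ℕ × ℕ)) =
          fun M => ∑ p ∈ antidiagonal M, E p := by
        funext M
        rw [tsum_fintype, Finset.sum_coe_sort]
      rw [hf]
      exact h.summable
  have h2 : Summable (E ∘ Finset.HasAntidiagonal.sigmaAntidiagonalEquivProd) := by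
    refine h1.congr fun x => ?_
    simp [Finset.HasAntidiagonal.sigmaAntidiagonalEquivProd]
  exact (Equiv.summable_iff _).mp h2

/-- Dominated regrouping: if `|E| ≤ E⁺` entrywise, the antidiagonal block sums of `E⁺` are summable, and
the antidiagonal block sums of `E` have sum `S`, then `E` has sum `S` as a double series. [folklore] -/
theorem hasSum_of_hasSum_antidiagonal_of_abs_le {E Ep : ℕ × ℕ → ℝ} (hle : ∀ p, |E p| ≤ Ep p)
    {Sp : ℝ} (hp : HasSum (fun M : ℕ => ∑ p ∈ antidiagonal M, Ep p) Sp) {S : ℝ}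
    (h : HasSum (fun M : ℕ => ∑ p ∈ antidiagonal M, E p) S) : HasSum E S := by
  have hEp : Summable Ep :=
    summable_of_hasSum_antidiagonal_of_nonneg (fun p => (abs_nonneg _).trans (hle p)) hp
  have hE : Summable E :=
    Summable.of_norm_bounded hEp (fun p => by rw [Real.norm_eq_abs]; exact hle p)
  have h3 : ∑' p, E p = S := (hasSum_sum_antidiagonal_of_summable hE).unique h
  rw [← h3]
  exact hE.hasSum

/-! ### Regrouping a radial series into a double power series in `(s,u) = (√ρ, √ρ̄)` -/

/-- The monomial coefficient array, in the square-root coordinates, of the radial series with table `d`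
and base spin `ℓ`: at `(a,b)` with `a + b = 2N`, `N ≥ ℓ`, the finite sum `Σ_{j ≤ N} d(N-ℓ, j)·radialArr N j (a,b)`;
zero at odd total degree or below degree `2ℓ`. [folklore] -/
noncomputable def radialMonArr (ℓ : ℕ) (d : ℕ × ℕ → ℝ) (p : ℕ × ℕ) : ℝ :=
  if (p.1 + p.2) % 2 = 0 ∧ 2 * ℓ ≤ p.1 + p.2 then
    ∑ j ∈ range ((p.1 + p.2) / 2 + 1), d ((p.1 + p.2) / 2 - ℓ, j) * radialArr ((p.1 + p.2) / 2) j p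
  else 0

/-- On the antidiagonal of degree `2(ℓ+m)` the array is the level-`m` combination. [folklore] -/
theorem radialMonArr_of_mem {ℓ : ℕ} (d : ℕ × ℕ → ℝ) {m : ℕ} {p : ℕ × ℕ}
    (hp : p ∈ antidiagonal (2 * (ℓ + m))) :
    radialMonArr ℓ d p = ∑ j ∈ range (ℓ + m + 1), d (m, j) * radialArr (ℓ + m) j p := by
  rw [mem_antidiagonal] at hp
  unfold radialMonArr
  rw [if_pos ⟨by omega, by omega⟩]
  have h1 : (p.1 + p.2) / 2 = ℓ + m := by omega
  rw [h1, Nat.add_sub_cancel_left]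

/-- `|radialMonArr ℓ d| ≤ radialMonArr ℓ |d|` entrywise (`radialArr ≥ 0`). [folklore] -/
theorem abs_radialMonArr_le (ℓ : ℕ) (d : ℕ × ℕ → ℝ) (p : ℕ × ℕ) :
    |radialMonArr ℓ d p| ≤ radialMonArr ℓ (fun q => |d q|) p := by
  unfold radialMonArr
  split_ifs
  · refine (abs_sum_le_sum_abs _ _).trans (le_of_eq (sum_congr rfl fun j _ => ?_))
    rw [abs_mul, abs_of_nonneg (radialArr_nonneg _ _ _)]
  · simp

/-- **One radial term in the square-root coordinates**: for `j ≤ ℓ + m` and `s, u > 0`,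
`d·𝒫_{Δ+m,j}(s²,u²) = (su)^{Δ-ℓ} Σ_{a+b=2(ℓ+m)} d·radialArr (ℓ+m) j (a,b) s^a u^b`.
[cite: HogervorstRychkov2013, §3 eq. (3.6)] -/
theorem mul_zMono_sq_sq {ℓ : ℕ} {Δ s u : ℝ} (hs : 0 < s) (hu : 0 < u) (d : ℝ) {m j : ℕ}
    (hj : j ≤ ℓ + m) :
    d * zMono (Δ + (m : ℝ)) j (s ^ 2) (u ^ 2) =
      (s * u) ^ (Δ - (ℓ : ℝ)) *
        ∑ p ∈ antidiagonal (2 * (ℓ + m)), d * radialArr (ℓ + m) j p * s ^ p.1 * u ^ p.2 := by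
  have hsu : 0 < s * u := mul_pos hs hu
  have hpow : (s ^ 2 * u ^ 2) ^ ((Δ + (m : ℝ) - (j : ℝ)) / 2) =
      (s * u) ^ (Δ - (ℓ : ℝ)) * (s * u) ^ (ℓ + m - j) := by
    rw [show s ^ 2 * u ^ 2 = (s * u) ^ (2 : ℕ) by ring, ← Real.rpow_natCast (s * u) 2,
      ← Real.rpow_mul hsu.le, ← Real.rpow_natCast (s * u) (ℓ + m - j), ← Real.rpow_add hsu]
    congr 1
    rw [Nat.cast_sub hj]
    push_cast
    ring
  have hsum : ∑ p ∈ antidiagonal (2 * (ℓ + m)), d * radialArr (ℓ + m) j p * s ^ p.1 * u ^ p.2 =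
      d * ((s * u) ^ (ℓ + m - j) * zLegendre j (s ^ 2) (u ^ 2)) := by
    rw [← sum_antidiagonal_radialArr_mul_pow hj s u, mul_sum]
    exact sum_congr rfl fun p _ => by ring
  unfold zMono
  rw [hpow, hsum]
  ring

/-- **Row identity**: the level-`m` row of a supported radial series at `(s², u²)` is `(su)^{Δ-ℓ}` times
the degree-`2(ℓ+m)` block of the `(s,u)` double power series with coefficients `radialMonArr ℓ d`.
[folklore] -/
theorem sum_row_eq_mul_sum_antidiagonal {ℓ : ℕ} (d : ℕ × ℕ → ℝ) {Δ s u : ℝ} (hs : 0 < s)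
    (hu : 0 < u) (m : ℕ) :
    ∑ j ∈ range (ℓ + m + 1), d (m, j) * zMono (Δ + (m : ℝ)) j (s ^ 2) (u ^ 2) =
      (s * u) ^ (Δ - (ℓ : ℝ)) *
        ∑ p ∈ antidiagonal (2 * (ℓ + m)), radialMonArr ℓ d p * s ^ p.1 * u ^ p.2 := by
  calc ∑ j ∈ range (ℓ + m + 1), d (m, j) * zMono (Δ + (m : ℝ)) j (s ^ 2) (u ^ 2)
      = ∑ j ∈ range (ℓ + m + 1), (s * u) ^ (Δ - (ℓ : ℝ)) *
          ∑ p ∈ antidiagonal (2 * (ℓ + m)), d (m, j) * radialArr (ℓ + m) j p * s ^ p.1 * u ^ p.2 := by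
        refine sum_congr rfl fun j hj => ?_
        exact mul_zMono_sq_sq hs hu (d (m, j)) (by have := Finset.mem_range.mp hj; omega)
    _ = (s * u) ^ (Δ - (ℓ : ℝ)) * ∑ p ∈ antidiagonal (2 * (ℓ + m)),
          ∑ j ∈ range (ℓ + m + 1), d (m, j) * radialArr (ℓ + m) j p * s ^ p.1 * u ^ p.2 := by
        rw [← mul_sum, sum_comm]
    _ = _ := by
        congr 1
        refine sum_congr rfl fun p hp => ?_
        rw [radialMonArr_of_mem d hp, sum_mul, sum_mul]

/-- **Antidiagonal form of the regrouping**: if the radial series `Σ_q d_q 𝒫_{Δ+m,j}(s²,u²)` of a table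
supported on `j ≤ ℓ + m` has sum `S` (`s, u > 0`), then the block sums over the antidiagonals of the
`(s,u)` monomial family `radialMonArr ℓ d (a,b) s^a u^b` have sum `(su)^{-(Δ-ℓ)} S`. [folklore] -/
theorem hasSum_antidiagonal_radialMonArr {ℓ : ℕ} {d : ℕ × ℕ → ℝ} (hd : RadialSupport ℓ d)
    {Δ s u S : ℝ} (hs : 0 < s) (hu : 0 < u)
    (h : HasSum (fun q : ℕ × ℕ => d q * zMono (Δ + (q.1 : ℝ)) q.2 (s ^ 2) (u ^ 2)) S) :
    HasSum (fun M : ℕ => ∑ p ∈ antidiagonal M, radialMonArr ℓ d p * s ^ p.1 * u ^ p.2)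
      ((s * u) ^ (-(Δ - (ℓ : ℝ))) * S) := by
  have hsu : 0 < s * u := mul_pos hs hu
  have hC0 : 0 < (s * u) ^ (Δ - (ℓ : ℝ)) := Real.rpow_pos_of_pos hsu _
  -- rows are finitely supported
  have hrow : ∀ m : ℕ, HasSum (fun j : ℕ => d (m, j) * zMono (Δ + (m : ℝ)) j (s ^ 2) (u ^ 2))
      (∑ j ∈ range (ℓ + m + 1), d (m, j) * zMono (Δ + (m : ℝ)) j (s ^ 2) (u ^ 2)) := by
    intro m
    refine hasSum_sum_of_ne_finset_zero fun j hj => ?_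
    rw [Finset.mem_range, not_lt] at hj
    rw [hd (m, j) (by simp only; omega), zero_mul]
  have h1 : HasSum (fun m : ℕ => ∑ j ∈ range (ℓ + m + 1),
      d (m, j) * zMono (Δ + (m : ℝ)) j (s ^ 2) (u ^ 2)) S := h.prod_fiberwise hrow
  simp only [sum_row_eq_mul_sum_antidiagonal d hs hu] at h1
  have h2 := h1.mul_left ((s * u) ^ (Δ - (ℓ : ℝ)))⁻¹
  simp only [← mul_assoc, inv_mul_cancel₀ hC0.ne', one_mul] at h2
  rw [← Real.rpow_neg hsu.le] at h2
  -- extend from the even degrees `2(ℓ+m)` to all degrees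
  have hinj : Function.Injective (fun m : ℕ => 2 * (ℓ + m)) := fun a b hab => by
    simp only at hab
    omega
  have hoff : ∀ M ∉ Set.range (fun m : ℕ => 2 * (ℓ + m)),
      ∑ p ∈ antidiagonal M, radialMonArr ℓ d p * s ^ p.1 * u ^ p.2 = 0 := by
    intro M hM
    refine sum_eq_zero fun p hp => ?_
    rw [mem_antidiagonal] at hp
    have h0 : radialMonArr ℓ d p = 0 := by
      unfold radialMonArr
      rw [if_neg]
      rintro ⟨he, hle⟩
      exact hM ⟨(p.1 + p.2) / 2 - ℓ, by simp only; omega⟩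
    rw [h0, zero_mul, zero_mul]
  exact (hinj.hasSum_iff hoff).mp h2

/-- **Regrouping theorem.** Under the hypotheses of `hasSum_antidiagonal_radialMonArr` the `(s,u)`
monomial family itself has sum `(su)^{-(Δ-ℓ)} S` as a double series: the radial series of the table
`|d|` converges too (unconditional convergence over `ℕ × ℕ` in `ℝ` is absolute), and it dominates the
regrouping. [folklore] -/
theorem hasSum_radialMonArr {ℓ : ℕ} {d : ℕ × ℕ → ℝ} (hd : RadialSupport ℓ d) {Δ s u S : ℝ}
    (hs : 0 < s) (hu : 0 < u)
    (h : HasSum (fun q : ℕ × ℕ => d q * zMono (Δ + (q.1 : ℝ)) q.2 (s ^ 2) (u ^ 2)) S) :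
    HasSum (fun p : ℕ × ℕ => radialMonArr ℓ d p * s ^ p.1 * u ^ p.2)
      ((s * u) ^ (-(Δ - (ℓ : ℝ))) * S) := by
  have hx : 0 ≤ s ^ 2 := sq_nonneg s
  have hy : 0 ≤ u ^ 2 := sq_nonneg u
  have habs : HasSum (fun q : ℕ × ℕ => |d q| * zMono (Δ + (q.1 : ℝ)) q.2 (s ^ 2) (u ^ 2))
      (∑' q : ℕ × ℕ, |d q * zMono (Δ + (q.1 : ℝ)) q.2 (s ^ 2) (u ^ 2)|) := by
    refine h.summable.abs.hasSum.congr_fun fun q => ?_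
    rw [abs_mul, abs_of_nonneg (zMono_nonneg _ _ hx hy)]
  have hp := hasSum_antidiagonal_radialMonArr hd.abs hs hu habs
  have hm := hasSum_antidiagonal_radialMonArr hd hs hu h
  refine hasSum_of_hasSum_antidiagonal_of_abs_le (fun p => ?_) hp hm
  rw [abs_mul, abs_mul, abs_of_nonneg (pow_nonneg hs.le _), abs_of_nonneg (pow_nonneg hu.le _)]
  exact mul_le_mul_of_nonneg_right
    (mul_le_mul_of_nonneg_right (abs_radialMonArr_le ℓ d p) (pow_nonneg hs.le _)) (pow_nonneg hu.le _)

/-! ### Uniqueness of the radial table -/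

/-- **A radial series that sums to zero on a square has zero table.** If `d` is supported on `j ≤ ℓ + m`
and `Σ_{(m,j)} d(m,j) 𝒫_{Δ+m,j}(ρ,ρ̄)` converges (unconditionally) to `0` at every point of a square
`(0,δ)²`, `δ > 0`, then `d = 0`. (Hogervorst–Rychkov 2013 §3 "first method" read backwards: the
monomial coefficients in `(√ρ, √ρ̄)` vanish by the identity theorem, and they determine the spin
coefficients level by level.) [cite: HogervorstRychkov2013, §3 eqs. (3.4)–(3.6)] -/
theorem RadialSupport.eq_zero_of_hasSum_zero {ℓ : ℕ} {d : ℕ × ℕ → ℝ} (hd : RadialSupport ℓ d)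
    (Δ : ℝ) {δ : ℝ} (hδ : 0 < δ)
    (h : ∀ ρ ρb : ℝ, 0 < ρ → ρ < δ → 0 < ρb → ρb < δ →
      HasSum (fun q : ℕ × ℕ => d q * zMono (Δ + (q.1 : ℝ)) q.2 ρ ρb) 0) :
    d = 0 := by
  -- the `(s,u)` monomial coefficients vanish
  have hsq : 0 < Real.sqrt δ := Real.sqrt_pos.mpr hδ
  have hE : radialMonArr ℓ d = 0 := by
    refine eq_zero_of_double_tsum_eq_zero_of_pos (radialMonArr ℓ d) hsq ?_
    intro s u hs0 hs1 hu0 hu1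
    have hs2 : s ^ 2 < δ := by
      calc s ^ 2 < Real.sqrt δ ^ 2 := by gcongr
        _ = δ := Real.sq_sqrt hδ.le
    have hu2 : u ^ 2 < δ := by
      calc u ^ 2 < Real.sqrt δ ^ 2 := by gcongr
        _ = δ := Real.sq_sqrt hδ.le
    have H := hasSum_radialMonArr hd hs0 hu0 (h (s ^ 2) (u ^ 2) (by positivity) hs2 (by positivity) hu2)
    rw [mul_zero] at H
    exact ⟨H.summable, H.tsum_eq⟩
  -- hence every spin coefficient vanishes
  funext q
  obtain ⟨m, j⟩ := q
  by_cases hj : ℓ + m < j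
  · exact hd (m, j) hj
  · rw [not_lt] at hj
    have hlev : ∀ p ∈ antidiagonal (2 * (ℓ + m)),
        ∑ j' ∈ range (ℓ + m + 1), d (m, j') * radialArr (ℓ + m) j' p = 0 := by
      intro p hp
      rw [← radialMonArr_of_mem d hp, hE, Pi.zero_apply]
    exact eq_zero_of_sum_radialArr_eq_zero (ℓ + m) (fun j' => d (m, j')) hlev j hj

/-- `z(ρ) > 0` for `ρ > 0`. [folklore] -/
theorem zOfRho_pos {ρ : ℝ} (hρ : 0 < ρ) : 0 < zOfRho ρ := by
  rw [zOfRho_def]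
  positivity

/-- **Uniqueness of the radial expansion of a function on the square.** Two radial expansions
`((1-z)(1-z̄))^c g = 4^Δ Σ w(m,j) 𝒫^ρ_{Δ+m,j}` and `= 4^Δ Σ w'(m,j) 𝒫^ρ_{Δ+m,j}` of the SAME function,
with the same prefactor exponent and base `(Δ, ℓ)`, both supported on `j ≤ ℓ + m`, have `w = w'`
(evaluate at `z = z(ρ)`, `ρ ∈ (0,1)`, where `ρ(z(ρ)) = ρ`, and apply `RadialSupport.eq_zero_of_hasSum_zero`
to `w - w'`). This is the radial analogue of the coefficient uniqueness (U) of the `z`-frame.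
[cite: HogervorstRychkov2013, §3 eqs. (3.1), (3.4)–(3.6)] -/
theorem HasRadialExpansion.unique {c Δ : ℝ} {ℓ : ℕ} {w w' : ℕ × ℕ → ℝ} {g : ℝ → ℝ → ℝ}
    (h : HasRadialExpansion c Δ w g) (h' : HasRadialExpansion c Δ w' g) (hw : RadialSupport ℓ w)
    (hw' : RadialSupport ℓ w') : w = w' := by
  have h4 : (0 : ℝ) < (4 : ℝ) ^ Δ := Real.rpow_pos_of_pos (by norm_num) Δ
  have key : ∀ a b M : ℝ,
      ((4 : ℝ) ^ Δ)⁻¹ * ((4 : ℝ) ^ Δ * a * M - (4 : ℝ) ^ Δ * b * M) = (a - b) * M := by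
    intro a b M
    have hc : ((4 : ℝ) ^ Δ)⁻¹ * (4 : ℝ) ^ Δ = 1 := inv_mul_cancel₀ h4.ne'
    calc ((4 : ℝ) ^ Δ)⁻¹ * ((4 : ℝ) ^ Δ * a * M - (4 : ℝ) ^ Δ * b * M)
        = (((4 : ℝ) ^ Δ)⁻¹ * (4 : ℝ) ^ Δ) * ((a - b) * M) := by ring
      _ = (a - b) * M := by rw [hc, one_mul]
  have hd := (hw.sub hw').eq_zero_of_hasSum_zero Δ one_pos (by
    intro ρ ρb hρ0 hρ1 hρb0 hρb1
    have hx : zOfRho ρ ∈ Ioo (0 : ℝ) 1 := ⟨zOfRho_pos hρ0, zOfRho_lt_one (by linarith) hρ1.ne⟩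
    have hy : zOfRho ρb ∈ Ioo (0 : ℝ) 1 := ⟨zOfRho_pos hρb0, zOfRho_lt_one (by linarith) hρb1.ne⟩
    have H := ((h _ _ hx hy).sub (h' _ _ hx hy)).mul_left (((4 : ℝ) ^ Δ)⁻¹)
    rw [sub_self, mul_zero] at H
    have hfun : (fun q : ℕ × ℕ => (w q - w' q) * zMono (Δ + (q.1 : ℝ)) q.2 ρ ρb) =
        fun q : ℕ × ℕ => ((4 : ℝ) ^ Δ)⁻¹ *
          ((4 : ℝ) ^ Δ * w q * radialMono (Δ + (q.1 : ℝ)) q.2 (zOfRho ρ) (zOfRho ρb) -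
            (4 : ℝ) ^ Δ * w' q * radialMono (Δ + (q.1 : ℝ)) q.2 (zOfRho ρ) (zOfRho ρb)) := by
      funext q
      simp only [radialMono, rhoOf_zOfRho (by linarith : (-1 : ℝ) < ρ) hρ1.le,
        rhoOf_zOfRho (by linarith : (-1 : ℝ) < ρb) hρb1.le]
      exact (key _ _ _).symm
    rw [hfun]
    exact H)
  funext q
  have := congrFun hd q
  simp only [Pi.zero_apply, sub_eq_zero] at this
  exact this

/-- The signed expansion is the unsigned expansion of the signed table with prefactor exponent `0`.
[folklore] -/
theorem hasSignedRadialExpansion_iff {Δ : ℝ} {w : ℕ × ℕ → ℝ} {g : ℝ → ℝ → ℝ} :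
    HasSignedRadialExpansion Δ w g ↔
      HasRadialExpansion 0 Δ (fun q => (-1 : ℝ) ^ q.1 * w q) g := by
  unfold HasSignedRadialExpansion HasRadialExpansion
  refine forall₄_congr fun x y _ _ => ?_
  rw [Real.rpow_zero, one_mul]
  refine Iff.intro (fun H => H.congr_fun fun q => by ring) (fun H => H.congr_fun fun q => by ring)

/-- **Uniqueness of the signed radial expansion** (the `⟨σεσε⟩` form `g = 4^Δ Σ (-1)^m w(m,j) 𝒫^ρ`):
two supported tables expanding the same function coincide. [cite: HogervorstRychkov2013, §3 eqs. (3.4)–(3.6)] -/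
theorem HasSignedRadialExpansion.unique {Δ : ℝ} {ℓ : ℕ} {w w' : ℕ × ℕ → ℝ} {g : ℝ → ℝ → ℝ}
    (h : HasSignedRadialExpansion Δ w g) (h' : HasSignedRadialExpansion Δ w' g)
    (hw : RadialSupport ℓ w) (hw' : RadialSupport ℓ w') : w = w' := by
  have H := (hasSignedRadialExpansion_iff.mp h).unique (hasSignedRadialExpansion_iff.mp h')
    (hw.mul_left _) (hw'.mul_left _)
  funext q
  have h1 := congrFun H q
  have hne : ((-1 : ℝ) ^ q.1) ≠ 0 := pow_ne_zero _ (by norm_num)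
  exact mul_left_cancel₀ hne h1

/-- **The table of the radial pair clause is unique.** Under `RadialPairClause Δσ Δε Δ ℓ` (the content
of a radial block clause A2ρ at one point), for any typed pair `(g₁, g₂)` of odd-sector blocks, ANY
supported table `wr'` giving the prefactored radial expansion of the `⟨εσσε⟩` block `g₂` coincides with
the clause's table; in particular the clause's own witness is unique, and so is the signed table of `g₁`.
The clause thus adds no datum beyond the typed blocks themselves: a certificate that evaluates radial
terms with some table is evaluating THE radial table of the block, if the block has one.
[cite: CostaHansenPenedonesTrevisani2016, §2.1 eqs. (2.11), (2.15)] -/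
theorem RadialPairClause.table_unique {Δσ Δε Δ : ℝ} {ℓ : ℕ} (h : RadialPairClause Δσ Δε Δ ℓ)
    {g₁ g₂ : ℝ → ℝ → ℝ} (hg₁ : IsConformalBlock3D (Δσ - Δε) (Δσ - Δε) Δ ℓ g₁)
    (hg₂ : IsConformalBlock3D (-(Δσ - Δε)) (Δσ - Δε) Δ ℓ g₂) {wr' : ℕ × ℕ → ℝ}
    (hwr' : RadialSupport ℓ wr') (h₂' : HasRadialExpansion ((Δσ - Δε) / 2) Δ wr' g₂) :
    ∃ wr : ℕ × ℕ → ℝ, (∀ q, 0 ≤ wr q) ∧ RadialSupport ℓ wr ∧ HasSignedRadialExpansion Δ wr g₁ ∧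
      HasRadialExpansion ((Δσ - Δε) / 2) Δ wr g₂ ∧ wr' = wr := by
  obtain ⟨wr, hw, hsupp, h₁, h₂⟩ := h g₁ g₂ hg₁ hg₂
  exact ⟨wr, hw, hsupp, h₁, h₂, h₂'.unique h₂ hwr' hsupp⟩

/-- Corollary: under the clause, a supported table expanding the `⟨εσσε⟩` block is automatically
entrywise non-negative and ALSO gives the signed expansion of the `⟨σεσε⟩` block — the two hypotheses of
`oddPositive_of_radial` / `hasSum_oddForm_radial` for that table. [folklore] -/
theorem RadialPairClause.of_hasRadialExpansion {Δσ Δε Δ : ℝ} {ℓ : ℕ}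
    (h : RadialPairClause Δσ Δε Δ ℓ) {g₁ g₂ : ℝ → ℝ → ℝ}
    (hg₁ : IsConformalBlock3D (Δσ - Δε) (Δσ - Δε) Δ ℓ g₁)
    (hg₂ : IsConformalBlock3D (-(Δσ - Δε)) (Δσ - Δε) Δ ℓ g₂) {wr' : ℕ × ℕ → ℝ}
    (hwr' : RadialSupport ℓ wr') (h₂' : HasRadialExpansion ((Δσ - Δε) / 2) Δ wr' g₂) :
    (∀ q, 0 ≤ wr' q) ∧ HasSignedRadialExpansion Δ wr' g₁ := by
  obtain ⟨wr, hw, -, h₁, -, rfl⟩ := h.table_unique hg₁ hg₂ hwr' h₂'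
  exact ⟨hw, h₁⟩

/-! ### Level-wise certificates for table rows -/

/-- **Level-wise row certificate.** If the `(√ρ,√ρ̄)`-monomial array of a table `w` is known
(`radialMonArr ℓ w = Z`; for a typed block `Z` is the finite `z → ρ` conversion sum of
`RadialConversion`), then a candidate row `r` for level `m` IS the row `w(m,·)` on `j ≤ ℓ + m` as soon as
`Σ_{j ≤ ℓ+m} r j · radialArr (ℓ+m) j` matches `Z` on the antidiagonal `a + b = 2(ℓ+m)` — finitely many
polynomial identities (the Legendre triangularity `eq_zero_of_sum_radialArr_eq_zero`, one level at a
time; no other level enters). [folklore] -/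
theorem row_eq_of_sum_radialArr_eq {ℓ : ℕ} {w Z : ℕ × ℕ → ℝ} (hZ : radialMonArr ℓ w = Z) (m : ℕ)
    (r : ℕ → ℝ)
    (h : ∀ p ∈ antidiagonal (2 * (ℓ + m)), ∑ j ∈ range (ℓ + m + 1), r j * radialArr (ℓ + m) j p = Z p) :
    ∀ j, j ≤ ℓ + m → w (m, j) = r j := by
  intro j hj
  have key := eq_zero_of_sum_radialArr_eq_zero (ℓ + m) (fun j => w (m, j) - r j) (fun p hp => by
    have h1 : ∑ j ∈ range (ℓ + m + 1), w (m, j) * radialArr (ℓ + m) j p = Z p := by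
      rw [← radialMonArr_of_mem w hp, hZ]
    simp only [sub_mul, Finset.sum_sub_distrib, h1, h p hp, sub_self]) j hj
  exact sub_eq_zero.mp key

/-- The full row: with the support condition, a certified candidate row extended by zero is `w(m,·)`.
[folklore] -/
theorem RadialSupport.row_eq {ℓ : ℕ} {w Z : ℕ × ℕ → ℝ} (hw : RadialSupport ℓ w)
    (hZ : radialMonArr ℓ w = Z) (m : ℕ) (r : ℕ → ℝ) (hr : ∀ j, ℓ + m < j → r j = 0)
    (h : ∀ p ∈ antidiagonal (2 * (ℓ + m)), ∑ j ∈ range (ℓ + m + 1), r j * radialArr (ℓ + m) j p = Z p)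
    (j : ℕ) : w (m, j) = r j := by
  by_cases hj : j ≤ ℓ + m
  · exact row_eq_of_sum_radialArr_eq hZ m r h j hj
  · rw [hw (m, j) (not_le.mp hj), hr j (not_le.mp hj)]

end Literature.MathematicalPhysics.QuantumFieldTheory.ConformalBootstrap3D
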